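import Mathlib
import Summits.Ventures.HodgeRepro0.P8K3LatticeCDefs
import Summits.Ventures.HodgeRepro0.P8K3LatticeC1
import Summits.Ventures.HodgeRepro0.P8K3LatticeC2
import Summits.Ventures.HodgeRepro0.P8K3LatticeC3
import Summits.Ventures.HodgeRepro0.P8K3LatticeC4
import Summits.Ventures.HodgeRepro0.P8K3LatticeC5
import Summits.Ventures.HodgeRepro0.P8K3LatticeC6

/-!
# P8K3LatticeCDet (seat p8) — `Gm = Bcᵀ G25 Bc`, `P * GL * Q = diagonal d` and `|det Gm| = 16` for the family-(C) lattice

Assembles the identities from the product modules; no heavy evaluation here. Since `d` has fourteen 1's and four 2's, the Smith normal form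
of `Gm` is `(1¹⁴, 2⁴)`: the discriminant group of `L` is `(ℤ/2)⁴`.
-/

namespace HodgeRepro0.P8K3LatticeC

/-- Four times the Gram matrix of the ℤ-basis is `H * B * Hᵀ`. -/
theorem Gm_eq : H * B * H.transpose = (4 : ℤ) • Gm := by
  rw [← Ht_eq, H_mul_B, HB_mul_Ht, Gm4_eq]

/-- Diagonalisation of `GL` by unimodular matrices. -/
theorem P_Gm_Q : P * Gm * Q = Matrix.diagonal d := by
  rw [P_mul_Gm, PGm_mul_Q, Dm_eq]

/-- `|det Gm| = 16`. -/
theorem abs_det_Gm : |Gm.det| = 16 := by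
  have h := congrArg Matrix.det P_Gm_Q
  rw [Matrix.det_mul, Matrix.det_mul, Matrix.det_diagonal] at h
  have hP := det_unit_of_mul_eq_one P_mul_Pinv
  have hQ := det_unit_of_mul_eq_one Q_mul_Qinv
  have hd : ∏ i, d i = 16 := by rw [← FinVec.prod_eq]; rfl
  rw [hd] at h
  have : |P.det| * |Gm.det| * |Q.det| = 16 := by rw [← abs_mul, ← abs_mul, h]; norm_num
  rw [hP, hQ] at this; simpa using this

end HodgeRepro0.P8K3LatticeC
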